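import Summits.AtomisticToContinuum.HydrodynamicLimit.Theorems.BoxDissipativeWeakStrongRelativeEnergyStabilityGronwallPathwiseB
import HarnessLib

/-!
# Crux `EntropyAdmissibility` (stmt-AtomisticToContinuum-9903), line `mean_via_weak_strong` — stub `stub_pathwiseSigned` (C3a)

Registered stub C3a of the line `mean_via_weak_strong` of the crux
`Summit.AtomisticToContinuum.HydrodynamicLimit.Theses.BoxDissipativeWeakStrong.EntropyAdmissibility`:
the PATHWISE clamped relative-energy inequality of Březina–Feireisl (§3.2) along one good hard-sphere orbit with
pairwise distinct velocities at rational times, with the entropy (K2) defect entering SIGNED —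
`e(t) − e(0) ≤ C ∫_{(0,t]} e(s) ds + |K1-defect(t)| + K2-defect(t)`.

This is the landed `RES.sx_pathwise` (Theorems/BoxDissipativeWeakStrongRelativeEnergyStabilityGronwallPathwiseB.lean)
with its last summand un-maxed: in that proof the positive part enters only through the final `le_max_left`
(step `hD2`), before which the entropy boundary terms satisfy an IDENTITY; so the same assembly
(`sx_obs_decomp`, `sx_pieces_eq_reduced`, `sx_reduced_integral_le`, the exact energy / continuity / pressure pieces
and the monotonicity of the time integral) closes the signed inequality by linear arithmetic.

References: J. Březina, E. Feireisl, *Measure-valued solutions to the complete Euler system*, J. Math. Soc. Japan 70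
(2018), §3.2; E. Feireisl, M. Lukáčová-Medviďová, H. Mizerová, *Convergence of finite volume schemes for the Euler
equations via dissipative measure-valued solutions* (2018); H. Spohn, *Large Scale Dynamics of Interacting Particles*
(1991), Part II §3.
-/

noncomputable section

open MeasureTheory Filter Set
open scoped ENNReal Topology InnerProductSpace BigOperators

namespace Summit.AtomisticToContinuum.HydrodynamicLimit.Theorems.EAMeanWSa

open Literature.MathematicalPhysics.KineticTheory
open Summit.AtomisticToContinuum.HydrodynamicLimit.Theses
open Summit.AtomisticToContinuum.HydrodynamicLimit.Theorems.RES
open Literature.Analysis.FluidPDE Literature.Analysis.FunctionSpaces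
open Literature.Analysis.FluidPDE.CompressibleEuler
open Literature.Analysis.FluidPDE.CompressibleEuler.EulerPhase
open Literature.Analysis.FluidPDE.CompressibleEuler.StrongPointData

/-- **C3a — the PATHWISE clamped relative-energy inequality with SIGNED entropy defect (size M; copy of
`RES.sx_pathwise` deleting its final `le_max_left`).** Along a good orbit with pairwise distinct velocities at rational
times, `e(t) − e(0) ≤ C ∫_{(0,t]} e(s) ds + |K1-defect(t)| + K2-defect(t)` (NO positive part on the K2 defect: in the proof
of `RES.sx_pathwise` the step `hD2` is an IDENTITY before `le_max_left`).  Hypothesis bundle `S` and all other binders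
verbatim those of `RES.sx_pathwise` (Theorems/…RelativeEnergyStabilityGronwallPathwiseB.lean). Sources: BrezinaFeireisl2018 §3.2. -/
def Sig.stub_pathwiseSigned : Prop :=
  ∀ (η₀ η₁ η₁B σ T : ℝ) (F χ f : ℝ → ℝ) (ρ θ : ℝ → T3 → ℝ) (u : ℝ → T3 → V3),
    (AnalyticOnNhd ℝ F (Ioo (-η₀) η₀) ∧ EqOn hsExcessFreeEnergy F (Ico 0 η₀) ∧ 0 < η₁ ∧ η₁ ≤ η₁B ∧
      2 * η₁B < η₀ ∧ 0 < σ ∧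
      (∀ x, 0 < x → x * σ ^ 3 ≤ η₁B → f x = hsExcessFreeEnergy (x * σ ^ 3) ∧ χ x = hsCompressibility (x * σ ^ 3)) ∧
      (EulerEOS.monatomicExcess χ f).IsGibbs ∧ IsHardSphereEulerSolution σ T ρ u θ ∧
      ∀ t ∈ Ico 0 T, ∀ x, ρ t x * σ ^ 3 ≤ η₁ / 2) →
    ∀ (Φ : (N : ℕ) → HardSphereFlow (Literature.Analysis.FluidPDE.Torus.geometry (Fin 3)) (hsDiameter σ N) (N + 1))
      (ℓ : ℕ → ℝ), (∀ N, 0 < ℓ N ∧ ℓ N ≤ 1) → ∀ (N : ℕ) (z : Config (N + 1) (Fin 3) T3), z ∈ (Φ N).good →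
      (∀ q : ℚ, ∀ i j, i ≠ j → ((Φ N).flow (q : ℝ) z i).2 ≠ ((Φ N).flow (q : ℝ) z j).2) →
      BoxBalanceLawsFor σ N (Φ N) (ℓ N) z → ∀ (a b : ℝ), a ≤ b → ∀ t ∈ Ico 0 T,
      ∀ (C ρs : ℝ), ((N : ℝ) + 1)⁻¹ * (ℓ N ^ 3)⁻¹ ≤ ρs →
      (∀ s ∈ Icc 0 t, ∀ (x : T3) (v : EulerPhase),
        (v = 0 ∨ (0 < dens v ∧ 0 < ien v) ∨ (0 < dens v ∧ ien v = 0 ∧ dens v ≤ ρs)) →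
          reducedRHS (cutEOS σ η₁) (clamp a b) (pdAt T ρ u θ (s, x)) (dens v) (ien v) (mom v) ≤
            C * (pdAt T ρ u θ (s, x)).relEnergyZ (cutEOS σ η₁) (clamp a b) v) →
      clampedRelEnergyObs σ η₁ a b ρ u θ N (Φ N) (ℓ N) t z - clampedRelEnergyObs σ η₁ a b ρ u θ N (Φ N) (ℓ N) 0 z ≤
        C * (∫ s in Ioc 0 t, clampedRelEnergyObs σ η₁ a b ρ u θ N (Φ N) (ℓ N) s z) +
          |(∫ x, inner ℝ (boxState (ℓ N) ((Φ N).flow t z) x).2.1 (u t x)) -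
          (∫ x, inner ℝ (boxState (ℓ N) ((Φ N).flow 0 z) x).2.1 (u 0 x)) -
          ∫ s in Ioc 0 t, ∫ x,
            (inner ℝ (boxState (ℓ N) ((Φ N).flow s z) x).2.1
                (Torus.timeDerivWithin (Ico 0 T) u s x) +
              (∑ i, ∑ j, (boxState (ℓ N) ((Φ N).flow s z) x).2.1 i *
                  (boxState (ℓ N) ((Φ N).flow s z) x).2.1 j /
                  (boxState (ℓ N) ((Φ N).flow s z) x).1 *
                Torus.partialDeriv j (fun y => u s y i) x) +
              (boxState (ℓ N) ((Φ N).flow s z) x).1 *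
                  (2 / 3 * ((boxState (ℓ N) ((Φ N).flow s z) x).2.2 /
                      (boxState (ℓ N) ((Φ N).flow s z) x).1 -
                    ‖(boxState (ℓ N) ((Φ N).flow s z) x).2.1‖ ^ 2 /
                      (2 * (boxState (ℓ N) ((Φ N).flow s z) x).1 ^ 2))) *
                  cutCompressibility η₁ ((boxState (ℓ N) ((Φ N).flow s z) x).1 * σ ^ 3) *
                Torus.divergence (u s) x)| +
          ((∫ s in Ioc 0 t, ∫ x,
            ((boxState (ℓ N) ((Φ N).flow s z) x).1 *
                  max a (min ((cutEOS σ η₁).s (boxState (ℓ N) ((Φ N).flow s z) x).1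
              (2 / 3 * ((boxState (ℓ N) ((Φ N).flow s z) x).2.2 /
                  (boxState (ℓ N) ((Φ N).flow s z) x).1 -
                ‖(boxState (ℓ N) ((Φ N).flow s z) x).2.1‖ ^ 2 /
                  (2 * (boxState (ℓ N) ((Φ N).flow s z) x).1 ^ 2)))) b) *
                Torus.timeDerivWithin (Ico 0 T) θ s x +
              max a (min ((cutEOS σ η₁).s (boxState (ℓ N) ((Φ N).flow s z) x).1
              (2 / 3 * ((boxState (ℓ N) ((Φ N).flow s z) x).2.2 /
                  (boxState (ℓ N) ((Φ N).flow s z) x).1 -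
                ‖(boxState (ℓ N) ((Φ N).flow s z) x).2.1‖ ^ 2 /
                  (2 * (boxState (ℓ N) ((Φ N).flow s z) x).1 ^ 2)))) b) *
                inner ℝ (boxState (ℓ N) ((Φ N).flow s z) x).2.1 (Torus.gradient (θ s) x))) -
          (∫ x, (boxState (ℓ N) ((Φ N).flow t z) x).1 *
              max a (min ((cutEOS σ η₁).s (boxState (ℓ N) ((Φ N).flow t z) x).1
              (2 / 3 * ((boxState (ℓ N) ((Φ N).flow t z) x).2.2 /
                  (boxState (ℓ N) ((Φ N).flow t z) x).1 -
                ‖(boxState (ℓ N) ((Φ N).flow t z) x).2.1‖ ^ 2 /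
                  (2 * (boxState (ℓ N) ((Φ N).flow t z) x).1 ^ 2)))) b) * θ t x) +
          (∫ x, (boxState (ℓ N) ((Φ N).flow 0 z) x).1 *
              max a (min ((cutEOS σ η₁).s (boxState (ℓ N) ((Φ N).flow 0 z) x).1
              (2 / 3 * ((boxState (ℓ N) ((Φ N).flow 0 z) x).2.2 /
                  (boxState (ℓ N) ((Φ N).flow 0 z) x).1 -
                ‖(boxState (ℓ N) ((Φ N).flow 0 z) x).2.1‖ ^ 2 /
                  (2 * (boxState (ℓ N) ((Φ N).flow 0 z) x).1 ^ 2)))) b) * θ 0 x))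

section Pathwise

variable {η₀ η₁ η₁B σ T : ℝ} {F χ f : ℝ → ℝ} {ρ θ : ℝ → T3 → ℝ} {u : ℝ → T3 → V3}

variable (S : AnalyticOnNhd ℝ F (Ioo (-η₀) η₀) ∧ EqOn hsExcessFreeEnergy F (Ico 0 η₀) ∧ 0 < η₁ ∧ η₁ ≤ η₁B ∧
  2 * η₁B < η₀ ∧ 0 < σ ∧
  (∀ x, 0 < x → x * σ ^ 3 ≤ η₁B → f x = hsExcessFreeEnergy (x * σ ^ 3) ∧ χ x = hsCompressibility (x * σ ^ 3)) ∧
  (EulerEOS.monatomicExcess χ f).IsGibbs ∧ IsHardSphereEulerSolution σ T ρ u θ ∧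
  ∀ t ∈ Ico 0 T, ∀ x, ρ t x * σ ^ 3 ≤ η₁ / 2)
include S

/-- **The pathwise clamped relative-energy inequality with SIGNED entropy defect** (Březina–Feireisl §3.2 with zero
defect, along one good orbit with pairwise distinct velocities at rational times): with `e(s) = clampedRelEnergyObs … s z`,
`e(t) − e(0) ≤ C ∫_{(0,t]} e(s) ds + |K1-defect(t)| + K2-defect(t)`, where the two defects are VERBATIM the pathwise
functionals of `sx_fluxClosure_velocity` / `sx_entropyAdmissibility_temperature` at `τ := t`, and `C` is a pointwise
master constant valid at vacuum / hot / small-frozen box states (`dens ≤ ρs`, `((N+1)ℓ³)⁻¹ ≤ ρs`).  Same proof as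
`RES.sx_pathwise`, dropping its only use of `le_max_left` (the entropy boundary terms enter through an identity). -/
theorem sx_pathwise_signed
    (Φ : (N : ℕ) → HardSphereFlow (Literature.Analysis.FluidPDE.Torus.geometry (Fin 3)) (hsDiameter σ N) (N + 1))
    (ℓ : ℕ → ℝ) (hℓ : ∀ N, 0 < ℓ N ∧ ℓ N ≤ 1) (N : ℕ) {z : Config (N + 1) (Fin 3) T3} (hz : z ∈ (Φ N).good)
    (hq : ∀ q : ℚ, ∀ i j, i ≠ j → ((Φ N).flow (q : ℝ) z i).2 ≠ ((Φ N).flow (q : ℝ) z j).2)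
    (hBL : BoxBalanceLawsFor σ N (Φ N) (ℓ N) z) {a b : ℝ} (hab : a ≤ b) {t : ℝ} (ht : t ∈ Ico 0 T)
    {C ρs : ℝ} (hρs : ((N : ℝ) + 1)⁻¹ * (ℓ N ^ 3)⁻¹ ≤ ρs)
    (hmaster : ∀ s ∈ Icc 0 t, ∀ (x : T3) (v : EulerPhase),
      (v = 0 ∨ (0 < dens v ∧ 0 < ien v) ∨ (0 < dens v ∧ ien v = 0 ∧ dens v ≤ ρs)) →
        reducedRHS (cutEOS σ η₁) (clamp a b) (pdAt T ρ u θ (s, x)) (dens v) (ien v) (mom v) ≤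
          C * (pdAt T ρ u θ (s, x)).relEnergyZ (cutEOS σ η₁) (clamp a b) v) :
    clampedRelEnergyObs σ η₁ a b ρ u θ N (Φ N) (ℓ N) t z - clampedRelEnergyObs σ η₁ a b ρ u θ N (Φ N) (ℓ N) 0 z ≤
      C * (∫ s in Ioc 0 t, clampedRelEnergyObs σ η₁ a b ρ u θ N (Φ N) (ℓ N) s z) +
        |(∫ x, inner ℝ (boxState (ℓ N) ((Φ N).flow t z) x).2.1 (u t x)) -
        (∫ x, inner ℝ (boxState (ℓ N) ((Φ N).flow 0 z) x).2.1 (u 0 x)) -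
        ∫ s in Ioc 0 t, ∫ x,
          (inner ℝ (boxState (ℓ N) ((Φ N).flow s z) x).2.1
              (Torus.timeDerivWithin (Ico 0 T) u s x) +
            (∑ i, ∑ j, (boxState (ℓ N) ((Φ N).flow s z) x).2.1 i *
                (boxState (ℓ N) ((Φ N).flow s z) x).2.1 j /
                (boxState (ℓ N) ((Φ N).flow s z) x).1 *
              Torus.partialDeriv j (fun y => u s y i) x) +
            (boxState (ℓ N) ((Φ N).flow s z) x).1 *
                (2 / 3 * ((boxState (ℓ N) ((Φ N).flow s z) x).2.2 /
                    (boxState (ℓ N) ((Φ N).flow s z) x).1 -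
                  ‖(boxState (ℓ N) ((Φ N).flow s z) x).2.1‖ ^ 2 /
                    (2 * (boxState (ℓ N) ((Φ N).flow s z) x).1 ^ 2))) *
                cutCompressibility η₁ ((boxState (ℓ N) ((Φ N).flow s z) x).1 * σ ^ 3) *
              Torus.divergence (u s) x)| +
        ((∫ s in Ioc 0 t, ∫ x,
          ((boxState (ℓ N) ((Φ N).flow s z) x).1 *
                max a (min ((cutEOS σ η₁).s (boxState (ℓ N) ((Φ N).flow s z) x).1
            (2 / 3 * ((boxState (ℓ N) ((Φ N).flow s z) x).2.2 /
                (boxState (ℓ N) ((Φ N).flow s z) x).1 -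
              ‖(boxState (ℓ N) ((Φ N).flow s z) x).2.1‖ ^ 2 /
                (2 * (boxState (ℓ N) ((Φ N).flow s z) x).1 ^ 2)))) b) *
              Torus.timeDerivWithin (Ico 0 T) θ s x +
            max a (min ((cutEOS σ η₁).s (boxState (ℓ N) ((Φ N).flow s z) x).1
            (2 / 3 * ((boxState (ℓ N) ((Φ N).flow s z) x).2.2 /
                (boxState (ℓ N) ((Φ N).flow s z) x).1 -
              ‖(boxState (ℓ N) ((Φ N).flow s z) x).2.1‖ ^ 2 /
                (2 * (boxState (ℓ N) ((Φ N).flow s z) x).1 ^ 2)))) b) *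
              inner ℝ (boxState (ℓ N) ((Φ N).flow s z) x).2.1 (Torus.gradient (θ s) x))) -
        (∫ x, (boxState (ℓ N) ((Φ N).flow t z) x).1 *
            max a (min ((cutEOS σ η₁).s (boxState (ℓ N) ((Φ N).flow t z) x).1
            (2 / 3 * ((boxState (ℓ N) ((Φ N).flow t z) x).2.2 /
                (boxState (ℓ N) ((Φ N).flow t z) x).1 -
              ‖(boxState (ℓ N) ((Φ N).flow t z) x).2.1‖ ^ 2 /
                (2 * (boxState (ℓ N) ((Φ N).flow t z) x).1 ^ 2)))) b) * θ t x) +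
        (∫ x, (boxState (ℓ N) ((Φ N).flow 0 z) x).1 *
            max a (min ((cutEOS σ η₁).s (boxState (ℓ N) ((Φ N).flow 0 z) x).1
            (2 / 3 * ((boxState (ℓ N) ((Φ N).flow 0 z) x).2.2 /
                (boxState (ℓ N) ((Φ N).flow 0 z) x).1 -
              ‖(boxState (ℓ N) ((Φ N).flow 0 z) x).2.1‖ ^ 2 /
                (2 * (boxState (ℓ N) ((Φ N).flow 0 z) x).1 ^ 2)))) b) * θ 0 x)) := by
  have h0T : (0:ℝ) ∈ Ico 0 T := ⟨le_rfl, ht.1.trans_lt ht.2⟩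
  have hl : 0 < ℓ N := (hℓ N).1
  have hη₀ : 0 < η₀ := S.2.2.1.trans (sx_band_lt S)
  have hsol := S.2.2.2.2.2.2.2.2.1
  -- the four time-integrands and the observable, as functions of time
  set i₁ : ℝ → ℝ := fun s => ∫ x,
                        (inner ℝ (boxState (ℓ N) ((Φ N).flow s z) x).2.1
                            (Torus.timeDerivWithin (Ico 0 T) u s x) +
                          (∑ i, ∑ j, (boxState (ℓ N) ((Φ N).flow s z) x).2.1 i *
                              (boxState (ℓ N) ((Φ N).flow s z) x).2.1 j /
                              (boxState (ℓ N) ((Φ N).flow s z) x).1 *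
                            Torus.partialDeriv j (fun y => u s y i) x) +
                          (boxState (ℓ N) ((Φ N).flow s z) x).1 *
                              (2 / 3 * ((boxState (ℓ N) ((Φ N).flow s z) x).2.2 /
                                  (boxState (ℓ N) ((Φ N).flow s z) x).1 -
                                ‖(boxState (ℓ N) ((Φ N).flow s z) x).2.1‖ ^ 2 /
                                  (2 * (boxState (ℓ N) ((Φ N).flow s z) x).1 ^ 2))) *
                              cutCompressibility η₁ ((boxState (ℓ N) ((Φ N).flow s z) x).1 * σ ^ 3) *
                            Torus.divergence (u s) x) with hi₁
  set i₂ : ℝ → ℝ := fun s => ∫ x,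
                        ((boxState (ℓ N) ((Φ N).flow s z) x).1 *
                              max a (min ((cutEOS σ η₁).s (boxState (ℓ N) ((Φ N).flow s z) x).1
                                (2 / 3 * ((boxState (ℓ N) ((Φ N).flow s z) x).2.2 /
                                    (boxState (ℓ N) ((Φ N).flow s z) x).1 -
                                  ‖(boxState (ℓ N) ((Φ N).flow s z) x).2.1‖ ^ 2 /
                                    (2 * (boxState (ℓ N) ((Φ N).flow s z) x).1 ^ 2)))) b) *
                            Torus.timeDerivWithin (Ico 0 T) θ s x +
                          max a (min ((cutEOS σ η₁).s (boxState (ℓ N) ((Φ N).flow s z) x).1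
                                (2 / 3 * ((boxState (ℓ N) ((Φ N).flow s z) x).2.2 /
                                    (boxState (ℓ N) ((Φ N).flow s z) x).1 -
                                  ‖(boxState (ℓ N) ((Φ N).flow s z) x).2.1‖ ^ 2 /
                                    (2 * (boxState (ℓ N) ((Φ N).flow s z) x).1 ^ 2)))) b) *
                            inner ℝ (boxState (ℓ N) ((Φ N).flow s z) x).2.1 (Torus.gradient (θ s) x)) with hi₂
  set φ₁ := energyTestFunction (cutEOS σ η₁) ρ u θ with hφ₁
  set i₃ : ℝ → ℝ := fun s => ∫ x, ((boxState (ℓ N) ((Φ N).flow s z) x).1 * Torus.timeDerivWithin (Ico 0 T) φ₁ s x +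
      inner ℝ (boxState (ℓ N) ((Φ N).flow s z) x).2.1 (Torus.gradient (φ₁ s) x)) with hi₃
  set i₅ : ℝ → ℝ := fun s => ∫ x, (pdAt T ρ u θ (s, x)).pt (cutEOS σ η₁) with hi₅
  set e : ℝ → ℝ := fun s => clampedRelEnergyObs σ η₁ a b ρ u θ N (Φ N) (ℓ N) s z with he
  -- integrability in time
  have hK1 := FluxClosureB4.stub_boxIntegrableAlongFlow σ η₁ T Φ ℓ hℓ
  dsimp only at hK1
  have hI1 : IntegrableOn i₁ (Ioc 0 t) := (hK1 t ht u hsol.smooth_velocity N z hz).1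
  have hI2 : IntegrableOn i₂ (Ioc 0 t) :=
    sx_integrableOn_ent (sx_continuousOn_hsExcess S.1 S.2.1 hη₀) S.2.2.2.2.2.1 S.2.2.1 (sx_band_lt S) hsol (Φ N) hl hz
      hab ht
  obtain ⟨hI3, hE3⟩ := hBL.2.2.2 T φ₁ (sx_energyTest_smooth S) t ht
  obtain ⟨Np, hNp, hI5, -⟩ := sx_integrableOn_pt S ht
  obtain ⟨A, B, hobs⟩ := sx_integrableOn_obs S (Φ N) hl hab ht
  have hIe : IntegrableOn e (Ioc 0 t) := (hobs z hz).1
  -- exact pieces: energy, continuity, pressure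
  have hE1t : (∫ x, (boxState (ℓ N) ((Φ N).flow t z) x).2.2) = ((N : ℝ) + 1)⁻¹ * configEnergy ((Φ N).flow t z) :=
    hBL.2.1 t
  have hE10 : (∫ x, (boxState (ℓ N) ((Φ N).flow 0 z) x).2.2) = ((N : ℝ) + 1)⁻¹ * configEnergy ((Φ N).flow 0 z) :=
    hBL.2.1 0
  have hKEt := hBL.2.2.1 t
  have hKE0 := hBL.2.2.1 0
  have hE3' : (∫ x, (boxState (ℓ N) ((Φ N).flow t z) x).1 * φ₁ t x) -
      (∫ x, (boxState (ℓ N) ((Φ N).flow 0 z) x).1 * φ₁ 0 x) = ∫ s in Ioc 0 t, i₃ s := hE3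
  have hE5 := sx_pressure_ftc S ht hNp
  -- decomposition of the observable at `t` and at `0`
  have hdt := sx_obs_decomp S (Φ N) (ℓ N) a b z ht
  have hd0 := sx_obs_decomp S (Φ N) (ℓ N) a b z h0T
  -- the combination of the four time integrals is `≤ C ∫ e`
  have hpw : ∀ s ∈ Ioc 0 t, -i₁ s + i₃ s - i₂ s + i₅ s ≤ C * e s := by
    intro s hs
    have hs' : s ∈ Ico 0 T := ⟨hs.1.le, hs.2.trans_lt ht.2⟩
    have hdist := ad_distinct_of_rational (Φ N) hz hq s
    have h1 := (sx_pieces_eq_reduced S ((Φ N).flow s z) hdist hl a b hs').1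
    have h2 := sx_reduced_integral_le S ((Φ N).flow s z) hdist hl hs' hρs (hmaster s ⟨hs.1.le, hs.2⟩)
    simp only [hi₁, hi₂, hi₃, hi₅, he, hφ₁, clampedRelEnergyObs]
    rw [h1]
    exact h2
  have hI5' : IntegrableOn i₅ (Ioc 0 t) := hI5
  have hI3' : IntegrableOn i₃ (Ioc 0 t) := hI3
  have hI1n : IntegrableOn (fun s => -i₁ s) (Ioc 0 t) := hI1.neg
  have hA2 : IntegrableOn (fun s => -i₁ s + i₃ s) (Ioc 0 t) := hI1n.add hI3'
  have hA : IntegrableOn (fun s => -i₁ s + i₃ s - i₂ s) (Ioc 0 t) := hA2.sub hI2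
  have hint : (∫ s in Ioc 0 t, (-i₁ s + i₃ s - i₂ s + i₅ s)) =
      -(∫ s in Ioc 0 t, i₁ s) + (∫ s in Ioc 0 t, i₃ s) - (∫ s in Ioc 0 t, i₂ s) + ∫ s in Ioc 0 t, i₅ s := by
    have h1 := integral_add hA hI5'
    have h2 := integral_sub hA2 hI2
    have h3 := integral_add hI1n hI3'
    have h4 : (∫ s in Ioc 0 t, -i₁ s) = -∫ s in Ioc 0 t, i₁ s := integral_neg i₁
    linarith
  have hmono : (∫ s in Ioc 0 t, (-i₁ s + i₃ s - i₂ s + i₅ s)) ≤ ∫ s in Ioc 0 t, C * e s :=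
    setIntegral_mono_on (hA.add hI5') (hIe.const_mul C) measurableSet_Ioc hpw
  rw [integral_const_mul] at hmono
  -- the flux defect (the entropy defect enters SIGNED, through an identity)
  have hD1 : -((∫ x, inner ℝ (boxState (ℓ N) ((Φ N).flow t z) x).2.1 (u t x)) -
      (∫ x, inner ℝ (boxState (ℓ N) ((Φ N).flow 0 z) x).2.1 (u 0 x))) ≤ -(∫ s in Ioc 0 t, i₁ s) +
      |(∫ x, inner ℝ (boxState (ℓ N) ((Φ N).flow t z) x).2.1 (u t x)) -
        (∫ x, inner ℝ (boxState (ℓ N) ((Φ N).flow 0 z) x).2.1 (u 0 x)) - ∫ s in Ioc 0 t, i₁ s| := by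
    have := neg_le_abs ((∫ x, inner ℝ (boxState (ℓ N) ((Φ N).flow t z) x).2.1 (u t x)) -
      (∫ x, inner ℝ (boxState (ℓ N) ((Φ N).flow 0 z) x).2.1 (u 0 x)) - ∫ s in Ioc 0 t, i₁ s)
    linarith
  -- assemble
  simp only [he] at hmono
  rw [hKEt] at hE1t
  rw [hKE0] at hE10
  linarith [hdt, hd0, hE1t, hE10, hE3', hE5, hint, hmono, hD1]

end Pathwise

/-- **C3a, as registered**: the pathwise clamped relative-energy inequality with SIGNED entropy defect
(`Sig.stub_pathwiseSigned`), by `sx_pathwise_signed`. -/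
theorem stub_pathwiseSigned : Sig.stub_pathwiseSigned :=
  fun _η₀ _η₁ _η₁B _σ _T _F _χ _f _ρ _θ _u S Φ ℓ hℓ N _z hz hq hBL _a _b hab _t ht _C _ρs hρs hmaster =>
    sx_pathwise_signed S Φ ℓ hℓ N hz hq hBL hab ht hρs hmaster

end Summit.AtomisticToContinuum.HydrodynamicLimit.Theorems.EAMeanWSa

end
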